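import Literature.Topology.FourManifolds.AttachmentBoundaryPieces
import Literature.Topology.FourManifolds.OpenEmbeddingBoundaryRestrict
import HarnessLib

/-!
# The boundary of `D⁴ ∪_h̄ H²` is the surgery on the framed attaching circle (Kirby I, Lemma 2.1)

Topic `Literature/Topology/FourManifolds`; the `4 → 3` boundary passage behind Kirby calculus,
between the tree's two relational languages: Kosinski's handle attachments
(`HandleAttachingMap.IsMultiAttachment`; Kosinski 1993, VI §6: `P` is glued from `D⁴ ∖ h̄(S)` and
`D⁴ ∖ S` along `x ∼ h̄ α x`) and integral Dehn surgery (`IsIntegralSurgery`, `surgeryRel`;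
`DehnSurgery.lean`: `Y` is glued from `S³ ∖ K` and `D̊² × S¹` along `ν (u, t v) ∼ (t u, v)`).

**Theorem** (`HandleAttachingMap.isOpenGluing_boundary`, `isIntegralSurgery_boundary`; Kirby
1989, Ch. I Lemma 2.1 and §2 p. 8; Gompf–Stipsicz 1999, §5.3 / Prop. 5.1.2).  Let
`h̄ : T → D⁴` be an attaching map of a 2-handle whose values on the unit disc bundle of
`T ∩ ∂D⁴` are an oriented tubular neighbourhood `ν` of the knot `K ⊂ S³ = ∂D⁴`
(`h̄ y = incl (ν (angle y, fibre y))` for `y` of depth `0`), and let `P` be `D⁴` with the handle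
attached along `h̄`.  Then for every boundary datum `bP` of `P`, `∂P = bP.carrier` is the open
gluing of `S³ ∖ K` and `D̊² × S¹` along `surgeryRel ν`; if `ν` has framing `n`, `∂P` is the
`n`-surgery on `K`.  Proof: restrict the two open embeddings of `P` to the boundary along the
parametrisations of `AttachmentBoundaryPieces.lean` (`OpenEmbeddingBoundaryRestrict.lean`); the
boundary points of `P` are covered since open embeddings preserve boundary points; and on the
boundary sphere Kosinski's relation `x ∼ h̄ α x` **is** the surgery relation: for `y = (θ, v, 0)`,
`α y = (‖v‖ θ, (1 - ‖v‖²)^{1/2} v/‖v‖)` (`handleInversion_mkVec_zero`), i.e. the solid-torus point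
`(‖v‖ θ, v/‖v‖)`, glued to `h̄ y = ν (θ, v) = ν (θ, ‖v‖ · v/‖v‖)`.
Everything here is proved; no named facts are introduced.

## References

* R. C. Kirby, *The Topology of 4-Manifolds*, LNM 1374 (1989), Ch. I §2, Lemma 2.1. [Kirby1989]
* R. E. Gompf, A. I. Stipsicz, *4-Manifolds and Kirby Calculus* (1999), §5.3. [GompfStipsicz1999]
* A. A. Kosinski, *Differential Manifolds*, Academic Press (1993), VI §6, (6.1). [Kosinski1993]
-/

open scoped Manifold ContDiff Topology
open Set Function Metric Filter Real

noncomputable section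

namespace Literature.Topology.FourManifolds

universe u

/-- Local notation: `𝔼 n` is the model Euclidean space `EuclideanSpace ℝ (Fin n)`. -/
local notation "𝔼 " n:arg => EuclideanSpace ℝ (Fin n)

/-- Local notation: `𝕊 n` is the unit sphere in `EuclideanSpace ℝ (Fin (n + 1))`. -/
local notation "𝕊 " n:arg => (Metric.sphere (0 : EuclideanSpace ℝ (Fin (n + 1))) 1)

/-- Local notation: `𝔻 n` is the closed unit ball in `EuclideanSpace ℝ (Fin n)`. -/
local notation "𝔻 " n:arg => (Metric.closedBall (0 : EuclideanSpace ℝ (Fin n)) 1)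

set_option quotPrecheck false in
/-- Local notation: Kosinski's tube `T ⊆ D⁴` of the circle `S¹ × 0`, as a type. -/
local notation "𝕋" => ↥(handleTube 3 2)

set_option quotPrecheck false in
/-- Local notation: the inclusion `S³ ↪ D⁴` of the boundary datum of the 4-disc. -/
local notation "ι₃" => (closedBallBoundaryData 3).incl

attribute [local instance] fact_finrank_euclideanSpace_succ

/-! ### §1 Kosinski's inversion `α` on the boundary sphere -/

/-- A block rescaling of `ℝ⁴` acts blockwise on `(x_λ, x_μ)`. [folklore] -/
theorem blockScale_lamEmbed_add_muEmbed (c d : ℝ) (a b : 𝔼 2) :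
    blockScale 2 c d (lamEmbed a + muEmbed b) = lamEmbed (c • a) + muEmbed (d • b) := by
  ext i
  fin_cases i <;> simp [blockScale_apply, lamEmbed, muEmbed]

/-- **`α` on the boundary sphere**: for `0 < ‖v‖ < 1`,
`α (θ, v, 0) = (‖v‖ θ, (1 - ‖v‖²)^{1/2} v/‖v‖)` — the point of `S³ ∖ S` with `x_λ = ‖v‖ θ` and
unit `x_μ`-direction `v/‖v‖`. [cite: Kosinski1993, VI (6.1)] -/
theorem handleInversion_mkVec_zero (θ : 𝕊 1) {v : 𝔼 2} (hv0 : v ≠ 0) (hv : ‖v‖ ^ 2 < 1) :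
    handleInversion 2 (mkVec (θ : 𝔼 2) v 0) =
      lamEmbed (‖v‖ • (θ : 𝔼 2)) + Real.sqrt (1 - ‖v‖ ^ 2) • muEmbed (‖v‖⁻¹ • v) := by
  have hpos : 0 < 1 - 0 - ‖v‖ ^ 2 := by linarith
  have hL : lamSq 2 (mkVec (θ : 𝔼 2) v 0) = 1 - ‖v‖ ^ 2 := by
    rw [lamSq_mkVec θ v hpos.le]; ring
  have hn : 0 < ‖v‖ := norm_pos_iff.2 hv0
  have hr : 0 < Real.sqrt (1 - ‖v‖ ^ 2) := Real.sqrt_pos.2 (by linarith)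
  rw [handleInversion_eq_blockScale, hL, mkVec, ← lamEmbed_smul, blockScale_lamEmbed_add_muEmbed,
    show (1 : ℝ) - 0 - ‖v‖ ^ 2 = 1 - ‖v‖ ^ 2 by ring,
    show (1 : ℝ) - (1 - ‖v‖ ^ 2) = ‖v‖ ^ 2 by ring, Real.sqrt_sq hn.le, ← muEmbed_smul, smul_smul,
    smul_smul]
  rw [div_mul_cancel₀ _ hr.ne', div_eq_mul_inv]

/-! ### §2 The glue relation on the boundary sphere is the surgery relation -/

namespace HandleAttachingMap

variable (g : HandleAttachingMap 3 2 (𝔻 4)) {K : Knot} (ν : Knot.TubularNbhd ⇑K)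
  (hbd : ∀ y : 𝕋, tubeDepth y = 0 → g.toFun y = ι₃ (ν (tubeAngle y, tubeFibre y)))

/-- `h̄ y ∈ ∂D⁴` iff `y` has depth `0` (open smooth embeddings preserve boundary points).
[cite: Kosinski1993, VI §6] -/
theorem apply_mem_range_incl_iff' (y : 𝕋) : g.toFun y ∈ range ι₃ ↔ tubeDepth y = 0 := by
  rw [(closedBallBoundaryData 3).range_incl,
    mem_boundary_iff_of_isSmoothEmbedding g.isSmoothEmbedding g.isOpen_range y,
    mem_boundary_opens_iff (handleTube 3 2) y, boundary_closedBall, tubeDepth_eq_zero_iff]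
  rfl

/-- A tube point of depth `0` is `(θ, v, 0)` for some angle `θ` and fibre `v`. [folklore] -/
theorem eq_mkTubePt_of_depth_zero (y : 𝕋) (hy : tubeDepth y = 0) :
    ∃ (θ : 𝕊 1) (v : 𝔼 2) (hv : 0 < 1 - 0 - ‖v‖ ^ 2), y = mkTubePt θ v 0 le_rfl hv := by
  have hv : ‖tubeFibre y‖ ^ 2 < 1 := by
    have := norm_tubeFibre_lt_one y; nlinarith [norm_nonneg (tubeFibre y)]
  refine ⟨tubeAngle y, tubeFibre y, by linarith, ?_⟩
  have hpos : 0 < 1 - tubeDepth y - ‖tubeFibre y‖ ^ 2 := by rw [hy]; linarith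
  conv_lhs => rw [← mkTubePt_tube y (tubeDepth_nonneg y) hpos]
  apply Subtype.ext; apply Subtype.ext
  show mkVec _ _ _ = mkVec _ _ _
  rw [hy]

include hbd in
/-- **Kosinski's relation on the boundary sphere is the surgery relation**:
`h̄.glueRel (incl x) (u, (1 - ‖u‖²)^{1/2} w) ↔ surgeryRel ν x (u, w)`.
[cite: Kirby1989, Ch. I §2 Lemma 2.1] -/
theorem glueRel_incl_beltBoundaryPt_iff (x : ↥K.complement) (b : ↥solidTorus) :
    g.glueRel (ι₃ x.1) (beltBoundaryPt b).1 ↔ surgeryRel ν x b := by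
  constructor
  · rintro ⟨y, hy1, hbvec, hxy⟩
    -- `y` has depth `0`: `y = (θ, v, 0)`, `h̄ y = incl (ν (θ, v))`
    have hy0 : tubeDepth y = 0 := (g.apply_mem_range_incl_iff' y).1 ⟨x.1, hxy⟩
    obtain ⟨θ, v, hvpos, hy'⟩ := eq_mkTubePt_of_depth_zero y hy0
    subst hy'
    have hv1 : ‖v‖ ^ 2 < 1 := by linarith
    have hv0 : v ≠ 0 := by
      intro h0
      apply hy1
      show lamSq 2 (mkVec (θ : 𝔼 2) v 0) = 1
      rw [lamSq_mkVec _ _ hvpos.le, h0, norm_zero]; ring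
    have hn : 0 < ‖v‖ := norm_pos_iff.2 hv0
    -- read off the solid torus point from `(beltBoundaryPt b) = α y`
    have hvec : beltBoundaryVec b =
        lamEmbed (‖v‖ • (θ : 𝔼 2)) + Real.sqrt (1 - ‖v‖ ^ 2) • muEmbed (‖v‖⁻¹ • v) := by
      have : beltBoundaryVec b = handleInversion 2 (mkVec (θ : 𝔼 2) v 0) := hbvec
      rw [this, handleInversion_mkVec_zero θ hv0 hv1]
    have h1 : b.1.1 = ‖v‖ • (θ : 𝔼 2) := by
      have := congrArg lamPart hvec
      rwa [lamPart_beltBoundaryVec, lamPart_add, lamPart_lamEmbed, lamPart_smul, lamPart_muEmbed,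
        smul_zero, add_zero] at this
    have hnb : ‖b.1.1‖ = ‖v‖ := by
      rw [h1, norm_smul, Real.norm_of_nonneg hn.le, norm_eq_of_mem_sphere θ, mul_one]
    have h2 : (b.1.2 : 𝔼 2) = ‖v‖⁻¹ • v := by
      have := congrArg muPart hvec
      rw [muPart_beltBoundaryVec, muPart_add, muPart_lamEmbed, muPart_smul, muPart_muEmbed, zero_add,
        hnb] at this
      exact smul_right_injective _ (Real.sqrt_pos.2 (by linarith : (0 : ℝ) < 1 - ‖v‖ ^ 2)).ne' this
    refine ⟨θ, ‖v‖, ⟨hn, by nlinarith⟩, h1, ?_⟩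
    -- `x = ν (θ, v) = ν (θ, ‖v‖ • v/‖v‖)`
    have hx : ι₃ x.1 = ι₃ (ν (θ, v)) := by
      rw [hxy, hbd _ (tubeDepth_mkTubePt _ _ _ _ _), tubeAngle_mkTubePt, tubeFibre_mkTubePt]
    have hx' : (x : 𝕊 3) = ν (θ, v) := (closedBallBoundaryData 3).injective_incl hx
    show (x : 𝕊 3) = ν (θ, ‖v‖ • (b.1.2 : 𝔼 2))
    rw [hx', h2, smul_smul, mul_inv_cancel₀ hn.ne', one_smul]
  · rintro ⟨u, t, ht, hb1, hx⟩
    set v : 𝔼 2 := t • (b.1.2 : 𝔼 2) with hv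
    have hnv : ‖v‖ = t := by
      rw [hv, norm_smul, Real.norm_of_nonneg ht.1.le, norm_eq_of_mem_sphere b.1.2, mul_one]
    have hv1 : ‖v‖ ^ 2 < 1 := by rw [hnv]; nlinarith [ht.1, ht.2]
    have hv0 : v ≠ 0 := by rw [← norm_ne_zero_iff, hnv]; exact ht.1.ne'
    have hvpos : 0 < 1 - 0 - ‖v‖ ^ 2 := by linarith
    refine ⟨mkTubePt u v 0 le_rfl hvpos, ?_, ?_, ?_⟩
    · show lamSq 2 (mkVec (u : 𝔼 2) v 0) ≠ 1
      rw [lamSq_mkVec _ _ hvpos.le, hnv]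
      nlinarith [ht.1]
    · show beltBoundaryVec b = handleInversion 2 (mkVec (u : 𝔼 2) v 0)
      rw [handleInversion_mkVec_zero u hv0 hv1, hnv, beltBoundaryVec, hb1, norm_smul,
        Real.norm_of_nonneg ht.1.le, norm_eq_of_mem_sphere u, mul_one, hv, smul_smul,
        inv_mul_cancel₀ ht.1.ne', one_smul]
    · rw [hbd _ (tubeDepth_mkTubePt _ _ _ _ _), tubeAngle_mkTubePt, tubeFibre_mkTubePt]
      exact congrArg _ hx

/-! ### §3 The boundary of the attachment is the surgery -/

include hbd in
/-- **The boundary of `D⁴ ∪_h̄ H²` is `S³` surgered along `ν`** (Kirby 1989, Ch. I Lemma 2.1), for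
every boundary datum `bP` of `P`: `bP.carrier` is the open gluing of `S³ ∖ K` and `D̊² × S¹`
along `surgeryRel ν`. [cite: Kirby1989, Ch. I §2 Lemma 2.1] -/
theorem isOpenGluing_boundary {P : Type u} [TopologicalSpace P] [ChartedSpace (EuclideanHalfSpace 4) P]
    [IsManifold (𝓡∂ 4) ∞ P]
    (hg : HandleAttachingMap.IsMultiAttachment (fun _ : Fin 1 => g) (𝓡∂ 4) P)
    (bP : BoundaryData (𝓡∂ 4) P (𝓡 3)) :
    IsOpenGluing (𝓡 3) (𝓘(ℝ, 𝔼 2).prod (𝓡 1)) (𝓡 3) (A := ↥K.complement) (B := ↥solidTorus)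
      (P := bP.carrier) (surgeryRel ν) := by
  obtain ⟨-, jA, jB, hjA, hjAo, hjB, hcov, hglue, -⟩ := hg
  haveI : Nonempty ↥K.complement := ⟨ν.basePoint⟩
  haveI : Nonempty ↥solidTorus := ⟨solidTorusBasePt⟩
  -- `∂P` is nonempty: it contains the image of a point of `S³ ∖ K`
  haveI : Nonempty bP.carrier := by
    have hb := BoundaryData.apply_mem_boundary hjA hjAo (g.complementPt_mem_boundary ν hbd) ν.basePoint
    rw [← bP.range_incl] at hb
    obtain ⟨z, -⟩ := hb
    exact ⟨z⟩
  -- the two restricted embeddings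
  set jA₀ := bP.boundaryRestrict jA (g.complementPt ν hbd) with hjA₀
  set jB₀ := bP.boundaryRestrict (jB 0) beltBoundaryPt with hjB₀
  obtain ⟨hA, hAo⟩ := bP.isSmoothEmbedding_boundaryRestrict hjA hjAo (g.complementPt_mem_boundary ν hbd)
    (g.contMDiff_complementPt ν hbd) (g.injective_complementPt ν hbd)
    (fun U hU => g.exists_image_complementPt_eq ν hbd hU) (g.complementInv_complementPt ν hbd)
    (g.contMDiffOn_complementInv ν hbd)
  have L : ((𝔼 2) × EuclideanSpace ℝ (Fin 1)) ≃L[ℝ] 𝔼 3 := ContinuousLinearEquiv.ofFinrankEq (by simp)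
  obtain ⟨hB, hBo⟩ := bP.isSmoothEmbedding_boundaryRestrict_of_boundaryless (hjB 0).1 (hjB 0).2
    beltBoundaryPt_mem_boundary contMDiff_beltBoundaryPt L injective_beltBoundaryPt
    (fun U hU => exists_image_beltBoundaryPt_eq hU) beltBoundaryInv_beltBoundaryPt
    (contMDiffOn_beltBoundaryInv.mono boundary_subset_good)
  refine ⟨jA₀, jB₀, hA, hAo, hB, hBo, ?_, fun x b => ?_⟩
  · -- cover: a point of `∂P` is `jA a` or `jB b` with `a`, `b` boundary points of the pieces
    refine eq_univ_of_forall fun z => ?_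
    have hz : bP.incl z ∈ range jA ∪ ⋃ i, range (jB i) := by rw [hcov]; exact mem_univ _
    rcases hz with ⟨a, ha⟩ | hz
    · exact Or.inl (bP.mem_range_boundaryRestrict hjA hjAo (g.complementPt_mem_boundary ν hbd)
        (fun a ha => g.mem_range_complementPt ν hbd ha) ha.symm)
    · obtain ⟨i, b, hb⟩ := mem_iUnion.1 hz
      have hi : i = 0 := Subsingleton.elim i 0
      subst hi
      exact Or.inr (bP.mem_range_boundaryRestrict (hjB 0).1 (hjB 0).2 beltBoundaryPt_mem_boundary
        (fun b hb => mem_range_beltBoundaryPt hb) hb.symm)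
  · -- the relation
    rw [← (g.glueRel_incl_beltBoundaryPt_iff ν hbd x b)]
    have key : jA₀ x = jB₀ b ↔ jA (g.complementPt ν hbd x) = jB 0 (beltBoundaryPt b) := by
      constructor
      · intro h
        have := congrArg bP.incl h
        rwa [hjA₀, hjB₀, bP.incl_boundaryRestrict hjA hjAo (g.complementPt_mem_boundary ν hbd),
          bP.incl_boundaryRestrict (hjB 0).1 (hjB 0).2 beltBoundaryPt_mem_boundary] at this
      · intro h
        apply bP.injective_incl
        rw [hjA₀, hjB₀, bP.incl_boundaryRestrict hjA hjAo (g.complementPt_mem_boundary ν hbd),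
          bP.incl_boundaryRestrict (hjB 0).1 (hjB 0).2 beltBoundaryPt_mem_boundary]
        exact h
    exact key.trans (hglue 0 _ _)

include hbd in
/-- **The boundary of `D⁴ ∪_h̄ H²` is the `n`-surgery on the framed attaching circle** (`ν` of
framing `n`): `IsIntegralSurgery (𝓡 3) bP.carrier K n` for every boundary datum `bP` of `P`.
[cite: Kirby1989, Ch. I §2 Lemma 2.1] -/
theorem isIntegralSurgery_boundary {P : Type u} [TopologicalSpace P]
    [ChartedSpace (EuclideanHalfSpace 4) P] [IsManifold (𝓡∂ 4) ∞ P]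
    (hg : HandleAttachingMap.IsMultiAttachment (fun _ : Fin 1 => g) (𝓡∂ 4) P)
    {n : ℤ} (hn : ν.HasFraming n) (bP : BoundaryData (𝓡∂ 4) P (𝓡 3)) :
    IsIntegralSurgery (𝓡 3) bP.carrier K n :=
  ⟨ν, hn, g.isOpenGluing_boundary ν hbd hg bP⟩

end HandleAttachingMap

end Literature.Topology.FourManifolds
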